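import Summits.BirchSwinnertonDyer.BirchSwinnertonDyer.Theorems.ClassRecordThreeCartanOnePlaceDegreeLawAtThreeGramPairing
import Summits.BirchSwinnertonDyer.BirchSwinnertonDyer.Theorems.ClassRecordThreeEulerHalvesAtThreeCartanCoverAssembly
import Mathlib.LinearAlgebra.Matrix.PosDef
import HarnessLib

/-!
# Crux NUM `CartanOnePlaceDegreeLawAtThree` (item 24801) — (GRAM) modulo discreteness: the Gram matrix

Seat `bsd-stepL-tam3-p1` g30 (LEAD of 24801; `--supports` 24801). THE BILINEAR-ALGEBRA HALF of the last open
content stub `(GRAM)` `PeterssonGram` of the `petarea` cut of (PET): given integer coordinates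
`e : 𝕃(u, Λ) ≃ ℤ^dd` of the period lattice whose coordinate vectors `b_i = e⁻¹(δ_i)` are `ℝ`-LINEARLY INDEPENDENT in
`S₂` of the cover (the discreteness input, which is where Eichler–Shimura injectivity on `Γ̄(q)` enters — NOT proved
here), the Gram matrix `S_ij = ⟨b_i, b_j⟩` of the component-summed real Petersson pairing over a `Γ̄(q)`-domain `Fq`
is positive definite, invariant under `coordRep e (latticeRep Λ u)` (re-indexing of the component sum), and its
quadratic form at `e v` is the component-summed Petersson norm of `v ∈ 𝕃` (`peterssonGram_of_linearIndependent`).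
So (GRAM) = this theorem + «`𝕃(u, Λ)` is a free `ℤ`-module of finite rank with an `ℝ`-independent basis».
Nothing about NUM or any curve; BSD is proved for no curve. [cite: ShimuraIATAF1971, §3.5 and Thm. 8.4] [cite: CaiShuTian2014, §1.2 p. 5]
-/

set_option linter.dupNamespace false
set_option autoImplicit false

noncomputable section

open scoped Classical Pointwise MatrixGroups ModularForm ENNReal UpperHalfPlane ComplexConjugate
open MeasureTheory Matrix

namespace Summit.BirchSwinnertonDyer.BirchSwinnertonDyer.Theorems.CartanCover

open Literature.NumberTheory.Automorphic Literature.NumberTheory.EllipticCurves.ModularForms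
open Summit.BirchSwinnertonDyer.BirchSwinnertonDyer.Theorems

variable {D M : ℕ} {C : Finset ℕ} {X : CartanLevelCurveData D M C} {q : ℕ}

namespace CoverReduction

variable [Fact q.Prime] (R : CoverReduction X q)

omit [Fact q.Prime] in
/-- Real scalar multiplication on the induced module is complex scalar multiplication by a real. -/
theorem real_smul_eq (c : ℝ) (v : R.IndCuspForm) : c • v = (c : ℂ) • v := (Complex.coe_smul c v).symm

/-- `ℂ[G]·u` is closed under real linear combinations. -/
theorem sum_smul_mem_spanG (u : R.IndCuspForm) {ι : Type*} (s : Finset ι) (c : ι → ℝ) (w : ι → R.IndCuspForm)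
    (hw : ∀ i, w i ∈ R.spanG u) : ∑ i ∈ s, (c i : ℂ) • w i ∈ R.spanG u :=
  Submodule.sum_mem _ fun i _ => Submodule.smul_mem _ _ (hw i)

/-- **Expansion of the pairing in the first variable** over a real linear combination of vectors of `ℂ[G]·u`. -/
theorem petPair_sum_smul_left {Fq : Set ℍ} (u : R.IndCuspForm) (hu : R.FinitePet Fq u) {ι : Type*} (s : Finset ι)
    (c : ι → ℝ) (w : ι → R.IndCuspForm) (hw : ∀ i, w i ∈ R.spanG u) {z : R.IndCuspForm} (hz : z ∈ R.spanG u) :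
    R.petPair Fq (∑ i ∈ s, (c i : ℂ) • w i) z = ∑ i ∈ s, c i * R.petPair Fq (w i) z := by
  induction s using Finset.induction_on with
  | empty =>
    simp only [Finset.sum_empty]
    unfold petPair
    simp
  | insert a s ha ih =>
    rw [Finset.sum_insert ha, Finset.sum_insert ha,
      R.petPair_add_left Fq (hu.of_mem_spanG (Submodule.smul_mem _ _ (hw a)))
        (hu.of_mem_spanG (R.sum_smul_mem_spanG u s c w hw)) (hu.of_mem_spanG hz),
      R.petPair_smul_left, ih]

/-- Expansion in both variables: `⟨Σ xᵢ bᵢ, Σ yⱼ bⱼ⟩ = Σᵢ Σⱼ xᵢ ⟨bᵢ, bⱼ⟩ yⱼ`. -/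
theorem petPair_sum_sum {Fq : Set ℍ} (u : R.IndCuspForm) (hu : R.FinitePet Fq u) {dd : ℕ}
    (bv : Fin dd → R.IndCuspForm) (hb : ∀ i, bv i ∈ R.spanG u) (x y : Fin dd → ℝ) :
    R.petPair Fq (∑ i, (x i : ℂ) • bv i) (∑ j, (y j : ℂ) • bv j) =
      ∑ i, ∑ j, x i * R.petPair Fq (bv i) (bv j) * y j := by
  rw [R.petPair_sum_smul_left u hu Finset.univ x bv hb (R.sum_smul_mem_spanG u Finset.univ y bv hb)]
  refine Finset.sum_congr rfl fun i _ => ?_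
  rw [R.petPair_comm, R.petPair_sum_smul_left u hu Finset.univ y bv hb (hb i), Finset.mul_sum]
  refine Finset.sum_congr rfl fun j _ => ?_
  rw [R.petPair_comm]
  ring

/-- **Coordinates**: every `w ∈ 𝕃` is `Σᵢ (e w)ᵢ · bᵢ` with `bᵢ = e⁻¹(δᵢ)`, as vectors of the induced module. -/
theorem coe_eq_sum_coord (Λ : Submodule ℤ ℂ) (u : R.IndCuspForm) {dd : ℕ} (e : R.periodLattice Λ u ≃ₗ[ℤ] (Fin dd → ℤ))
    (w : R.periodLattice Λ u) :
    (w : R.IndCuspForm) = ∑ i, (((e w) i : ℝ) : ℂ) • ((e.symm (Pi.single i 1) : R.periodLattice Λ u) : R.IndCuspForm) := by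
  have h1 : w = ∑ i, (e w) i • e.symm (Pi.single i 1) := by
    apply e.injective
    rw [map_sum]
    simp_rw [map_zsmul, LinearEquiv.apply_symm_apply]
    ext j
    simp [Finset.sum_apply, Pi.single_apply]
  conv_lhs => rw [h1]
  rw [AddSubgroup.val_finsetSum]
  refine Finset.sum_congr rfl fun i _ => ?_
  rw [AddSubgroupClass.coe_zsmul, Complex.ofReal_intCast]
  exact (Int.cast_smul_eq_zsmul ℂ ((e w) i) _).symm

/-- **(GRAM) modulo discreteness.** Let `Fq` be a `Γ̄(q)`-domain over which every component of `u` has finite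
Petersson norm, `e : 𝕃(u, Λ) ≃ ℤ^dd` integer coordinates whose coordinate vectors are `ℝ`-linearly independent in
the induced module. Then the Gram matrix of the real Petersson pairing is positive definite, `coordRep`-invariant,
and its quadratic form at `e v` is the component-summed Petersson norm of `v`. -/
theorem peterssonGram_of_linearIndependent (Λ : Submodule ℤ ℂ) (u : R.IndCuspForm) {Fq : Set ℍ}
    (hFq : IsHypFundamentalDomain (principalLevel X q) Fq) (hu : R.FinitePet Fq u) {dd : ℕ}
    (e : R.periodLattice Λ u ≃ₗ[ℤ] (Fin dd → ℤ))
    (hind : LinearIndependent ℝ fun i : Fin dd => ((e.symm (Pi.single i 1) : R.periodLattice Λ u) : R.IndCuspForm)) :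
    ∃ S : Matrix (Fin dd) (Fin dd) ℝ, S.PosDef ∧
      (∀ g', Matrix.transpose (CartanSchurForm.realMat (coordRep e (R.latticeRep Λ u)) g') * S *
          CartanSchurForm.realMat (coordRep e (R.latticeRep Λ u)) g' = S) ∧
      ∀ v : R.periodLattice Λ u,
        (fun i => ((e v) i : ℝ)) ⬝ᵥ (S *ᵥ fun i => ((e v) i : ℝ)) =
          (∑ g : GL (Fin 2) (ZMod q), ∫⁻ τ in Fq, ENNReal.ofReal (‖((v : R.IndCuspForm).1 g) τ‖ ^ 2 * τ.im ^ 2)).toReal := by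
  -- the basis vectors and the Gram matrix
  set bv : Fin dd → R.IndCuspForm := fun i => ((e.symm (Pi.single i 1) : R.periodLattice Λ u) : R.IndCuspForm) with hbv
  have hb : ∀ i, bv i ∈ R.spanG u := fun i => ((R.mem_periodLattice_iff Λ u _).mp (e.symm (Pi.single i 1)).2).1
  set S : Matrix (Fin dd) (Fin dd) ℝ := Matrix.of fun i j => R.petPair Fq (bv i) (bv j) with hS
  have hSij : ∀ i j, S i j = R.petPair Fq (bv i) (bv j) := fun i j => rfl
  -- the quadratic / bilinear form of `S` is the pairing of the combinations
  have hform : ∀ x y : Fin dd → ℝ, x ⬝ᵥ (S *ᵥ y) = R.petPair Fq (∑ i, (x i : ℂ) • bv i) (∑ j, (y j : ℂ) • bv j) := by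
    intro x y
    rw [R.petPair_sum_sum u hu bv hb x y]
    simp only [dotProduct, mulVec, hSij, Finset.mul_sum]
    refine Finset.sum_congr rfl fun i _ => Finset.sum_congr rfl fun j _ => ?_
    ring
  refine ⟨S, ?_, ?_, ?_⟩
  · -- positive definite
    refine Matrix.PosDef.of_dotProduct_mulVec_pos ?_ ?_
    · refine Matrix.IsHermitian.ext fun i j => ?_
      rw [hSij, hSij, star_trivial, R.petPair_comm]
    · intro x hx
      rw [star_trivial, hform]
      have hne : ∑ i, (x i : ℂ) • bv i ≠ 0 := by
        intro h0
        apply hx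
        have h0' : ∑ i, x i • bv i = 0 := by
          rw [← h0]
          exact Finset.sum_congr rfl fun i _ => R.real_smul_eq (x i) (bv i)
        funext i
        exact Fintype.linearIndependent_iff.mp hind x h0' i
      exact R.petPair_self_pos hFq (hu.of_mem_spanG (R.sum_smul_mem_spanG u Finset.univ x bv hb)) hne
  · -- invariance under `coordRep e (latticeRep Λ u)`
    intro g'
    set Mg := CartanSchurForm.realMat (coordRep e (R.latticeRep Λ u)) g' with hMg
    -- the columns of `Mg` are the coordinates of `g'·bⱼ`
    have hcol : ∀ j, ∑ i, (Mg i j : ℂ) • bv i = R.indRep g' (bv j) := by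
      intro j
      have hw := R.coe_eq_sum_coord Λ u e (R.latticeRep Λ u g' (e.symm (Pi.single j 1)))
      rw [coe_latticeRep_apply] at hw
      rw [hw]
      refine Finset.sum_congr rfl fun i _ => ?_
      congr 2
    ext j k
    rw [Matrix.mul_apply]
    simp_rw [Matrix.mul_apply, Matrix.transpose_apply]
    -- Σ_l (Σ_i Mg i j * S i l) * Mg l k = ⟨g' b_j, g' b_k⟩ = S j k
    have h1 : ∑ l, (∑ i, Mg i j * S i l) * Mg l k = (fun i => Mg i j) ⬝ᵥ (S *ᵥ fun l => Mg l k) := by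
      simp only [dotProduct, mulVec, Finset.sum_mul, Finset.mul_sum]
      rw [Finset.sum_comm]
      refine Finset.sum_congr rfl fun i _ => Finset.sum_congr rfl fun l _ => ?_
      ring
    rw [h1, hform, hcol, hcol]
    exact R.petPair_indRep Fq g' (bv j) (bv k)
  · -- the quadratic form at `e v`
    intro v
    rw [hform]
    have hv : ∑ i, (((e v) i : ℝ) : ℂ) • bv i = (v : R.IndCuspForm) := (R.coe_eq_sum_coord Λ u e v).symm
    rw [hv]
    exact R.petPair_self Fq (hu.of_mem_spanG ((R.mem_periodLattice_iff Λ u _).mp v.2).1)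

end CoverReduction

end Summit.BirchSwinnertonDyer.BirchSwinnertonDyer.Theorems.CartanCover

end
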